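import Summits.AnomalousDissipation.AnomalousDissipation.Theorems.GalerkinSteadyZerothLaw.Negative.LoadBearing
import Literature.Analysis.FluidPDE.NSHopfGalerkin
import Literature.Analysis.FunctionSpaces.TorusHNegOnePairing

/-!
# Diagnostics for the bet of the line `SketchIdeator1` (crux stmt-AnomalousDissipation-10352,
# `WazewskiBlock.UniformGalerkinTrap`): the registered stub `stub_steadyLoudAllLevels` implies the open sibling crux
# `MirrorVariety.GalerkinSteadyZerothLaw` (stmt-AnomalousDissipation-2986)

The lead's skeleton `Cruxes/UniformGalerkinTrap/Lines/SketchIdeator1.lean` closes `UniformGalerkinTrap` modulo ONE open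
stub, the card's declared bet (frozen-faces-coherent-structures, steady arm):

  `stub_steadyLoudAllLevels` : ∃ trig-poly mean-zero div-free `f`, `E, ε₀, ν₀ > 0` such that for every `0 < ν ≤ ν₀`
  there is `N₀` with, for EVERY `N ≥ N₀`, a mean-zero Galerkin mode `U` of order `N` solving the tested steady
  Galerkin equations against all Galerkin modes of order `N`, with `kineticEnergy U ≤ E` and `(f, U) ≥ ε₀`.

This definition-free support file records, kernel-checked, where that stub sits in the programme:

* `isGalerkinMode_of_bandLimited` / `steadyState_of_galerkinMode` — dictionary between the crux's Galerkin-mode bracket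
  (`IsGalerkinMode N`, tests of order `N`) and the steady bracket `GalerkinSteadyZerothLaw.Negative.SteadyState ν N f U`
  of the sibling cruxes (punctured ball `0 < |k|² ≤ N²`, mean-zero): for a mean-zero `U` they agree;
* `work_eq_of_steady` — on such a state the work IS the dissipation, `(f,U) = ν‖∇U‖²` (`Negative.energy_identity`);
* `galerkinSteadyZerothLaw_of_steadyLoudAllLevels` — **the stub implies `MirrorVariety.GalerkinSteadyZerothLaw`**
  (stmt-AnomalousDissipation-2986, rank 0, conjecture-grade, open): take `ν_j := ν₀/(j+1)`, `E' := 2E`, `ε := ε₀`;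
  `∀ N ≥ N₀(ν_j)` gives `∃ᶠ N`, and loudness `ε₀ ≤ (f,U) = ν_j‖∇U‖²`.

Consequence for the line (recorded in the lead's census): the bet is at least as strong as an open summit-strength crux
of another route (`∀ ν ≤ ν₀` ⊇ `ν_j → 0⁺`, `∀ N ≥ N₀` ⊇ `∃ᶠ N`, work floor ⇒ dissipation floor), so every negative fact
landed for 2986 (`Theorems/GalerkinSteadyZerothLaw/Negative/*`: planar laminarisation, fixed-resolution quietness
`ε ≤ 4π²νN²E`, scale covariance) applies to it verbatim, and a proof of the stub would close 2986 on the way.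

References: R. Temam, *Navier–Stokes Equations* (1979) Ch. II §1 (1.25)–(1.29); the sibling negative-knowledge files
`Theorems/GalerkinSteadyZerothLaw/Negative/LoadBearing.lean`, `Theorems/TaylorGreenLoudGalerkinStates/Negative/LoadBearing.lean`.
-/

noncomputable section

-- `Summit.<Summit>.<Problem>` is the tree's mandated summit-side namespace (CONVENTIONS §2); deliberate duplicate.
set_option linter.dupNamespace false

open MeasureTheory Filter Set UnitAddTorus
open scoped InnerProductSpace Topology

namespace Summit.AnomalousDissipation.AnomalousDissipation.Theorems.UniformGalerkinTrap

open Literature.Analysis.FunctionSpaces Literature.Analysis.FunctionSpaces.Torus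
open Literature.Analysis.FluidPDE
open Summit.AnomalousDissipation.AnomalousDissipation.Theses.MirrorVariety (GalerkinSteadyZerothLaw)
open Summit.AnomalousDissipation.AnomalousDissipation.Theorems.GalerkinSteadyZerothLaw.Negative
  (BandLimited SteadyState energy_identity)

variable {d : Type*} [Fintype d] [DecidableEq d]

/-! ## §1 Dictionary: Galerkin modes of order `N` vs. the punctured-ball steady bracket -/

/-- A smooth divergence-free field band-limited to the punctured ball `0 < |k|² ≤ N²` is a Galerkin mode of order `N`
(frequencies with `|k|² > N²` lie outside the ball, a fortiori outside the punctured ball). [folklore] -/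
theorem isGalerkinMode_of_bandLimited {N : ℕ} {a : UnitAddTorus d → EuclideanSpace ℝ d} (ha : IsSmooth a)
    (hdiv : IsDivFree a) (hband : BandLimited N a) : IsGalerkinMode N a :=
  ⟨ha, hdiv, fun k hk => hband k fun hmem => not_mem_freqBall.2 hk (Finset.mem_of_mem_erase hmem)⟩

/-- A mean-zero Galerkin mode of order `N` is band-limited to the punctured ball `0 < |k|² ≤ N²`: the zero mode is the
mean (`Torus.mFourierCoeff_complexify_zero_of_hasZeroMean`), the modes `|k|² > N²` vanish by definition. [folklore] -/
theorem bandLimited_of_isGalerkinMode {N : ℕ} {U : UnitAddTorus d → EuclideanSpace ℝ d} (hU : IsGalerkinMode N U)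
    (hmean : HasZeroMean U) : BandLimited N U := by
  intro k hk
  by_cases hk0 : k = 0
  · subst hk0
    exact mFourierCoeff_complexify_zero_of_hasZeroMean hU.isSmooth.continuous.integrable_unitAddTorus hmean
  · have hkball : k ∉ freqBall N := fun h => hk (Finset.mem_erase.2 ⟨hk0, h⟩)
    exact hU.mFourierCoeff_eq_zero (not_mem_freqBall.1 hkball)

/-- **Dictionary.** A mean-zero Galerkin mode of order `N` solving the tested steady Galerkin equations against every
Galerkin mode of order `N` is an admissible steady state `SteadyState ν N f U` of the sibling cruxes' bracket (smooth,
divergence-free, mean-zero, band-limited to the punctured ball, tested against every punctured-band-limited smooth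
divergence-free field — each of which is a Galerkin mode of order `N`). [folklore] -/
theorem steadyState_of_galerkinMode {ν : ℝ} {N : ℕ} {f U : UnitAddTorus d → EuclideanSpace ℝ d}
    (hU : IsGalerkinMode N U) (hmean : HasZeroMean U)
    (hsteady : ∀ a : UnitAddTorus d → EuclideanSpace ℝ d, IsGalerkinMode N a →
      ∫ x, (⟪U x, convect U a x⟫_ℝ + ν * ⟪U x, laplacian a x⟫_ℝ + ⟪f x, a x⟫_ℝ) = 0) :
    SteadyState ν N f U :=
  ⟨hU.isSmooth, hU.isDivFree, hmean, bandLimited_of_isGalerkinMode hU hmean,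
    fun _ ha hdiv hband => hsteady _ (isGalerkinMode_of_bandLimited ha hdiv hband)⟩

/-- **On a steady Galerkin state the work is the dissipation**: `∫⟪f,U⟫ = ν‖∇U‖²` for a mean-zero Galerkin mode of
order `N` solving the tested steady Galerkin equations (continuous `f`; test with `a := U`,
`Negative.energy_identity`, Temam 1979 Ch. II (1.29)). [folklore] -/
theorem work_eq_of_steady {ν : ℝ} {N : ℕ} {f U : UnitAddTorus d → EuclideanSpace ℝ d} (hf : Continuous f)
    (hU : IsGalerkinMode N U) (hmean : HasZeroMean U)
    (hsteady : ∀ a : UnitAddTorus d → EuclideanSpace ℝ d, IsGalerkinMode N a →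
      ∫ x, (⟪U x, convect U a x⟫_ℝ + ν * ⟪U x, laplacian a x⟫_ℝ + ⟪f x, a x⟫_ℝ) = 0) :
    ∫ x, ⟪f x, U x⟫_ℝ = ν * gradNormSq U :=
  (energy_identity (steadyState_of_galerkinMode hU hmean hsteady) hf).symm

/-! ## §2 The bet implies the sibling crux `GalerkinSteadyZerothLaw` -/

/-- **The line's bet implies `MirrorVariety.GalerkinSteadyZerothLaw` (stmt-AnomalousDissipation-2986).**
Hypothesis = the registered stub `stub_steadyLoudAllLevels` of `Cruxes/UniformGalerkinTrap/Lines/SketchIdeator1.lean`,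
verbatim (its transparent abbreviations `IsTrigPolyForce`, `SteadyLoudAllLevels` unfolded).  Proof: the same force;
viscosities `ν_j := ν₀/(j+1) → 0⁺`; budgets `E' := 2E` (`∫‖U‖² = 2·kineticEnergy U`) and `ε := ε₀`; at each `j` the
states exist for all `N ≥ N₀(ν_j)`, in particular frequently in `N`; each is an admissible steady state
(`steadyState_of_galerkinMode`) and is loud because `ε₀ ≤ (f,U) = ν_j‖∇U‖²` (`work_eq_of_steady`).  A CONDITIONAL
result recorded as a diagnostic of the line: it credits neither item. [folklore] -/
theorem galerkinSteadyZerothLaw_of_steadyLoudAllLevels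
    (hbet : ∃ (m : ℕ) (f : UnitAddTorus (Fin 3) → EuclideanSpace ℝ (Fin 3)),
      ((IsSmooth f ∧ IsDivFree f ∧ ∀ k : Fin 3 → ℤ, ((m : ℕ) : ℝ) ^ 2 < freqNormSq k →
        mFourierCoeff (EuclideanSpace.complexify ∘ f) k = 0) ∧ HasZeroMean f) ∧
      ∃ (E ε₀ ν₀ : ℝ), 0 < ε₀ ∧ 0 < ν₀ ∧
        ∀ ν : ℝ, 0 < ν → ν ≤ ν₀ → ∃ N₀ : ℕ, ∀ N : ℕ, N₀ ≤ N →
          ∃ U : UnitAddTorus (Fin 3) → EuclideanSpace ℝ (Fin 3), IsGalerkinMode N U ∧ HasZeroMean U ∧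
            (∀ a : UnitAddTorus (Fin 3) → EuclideanSpace ℝ (Fin 3), IsGalerkinMode N a →
              ∫ x, (⟪U x, convect U a x⟫_ℝ + ν * ⟪U x, laplacian a x⟫_ℝ + ⟪f x, a x⟫_ℝ) = 0) ∧
            kineticEnergy U ≤ E ∧ ε₀ ≤ ∫ x, inner ℝ (f x) (U x)) :
    GalerkinSteadyZerothLaw := by
  obtain ⟨m, f, ⟨⟨hfs, hfdiv, -⟩, hfmean⟩, E, ε₀, ν₀, hε₀, hν₀, h⟩ := hbet
  -- the viscosity ladder `ν_j := ν₀ / (j+1)`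
  set ν : ℕ → ℝ := fun j => ν₀ / ((j : ℝ) + 1) with hνdef
  have hνpos : ∀ j, 0 < ν j := fun j => by
    simp only [hνdef]
    positivity
  have hνle : ∀ j, ν j ≤ ν₀ := fun j => by
    simp only [hνdef]
    rw [div_le_iff₀ (by positivity : (0 : ℝ) < (j : ℝ) + 1)]
    nlinarith [(Nat.cast_nonneg j : (0 : ℝ) ≤ j)]
  have hνlim : Tendsto ν atTop (𝓝 0) := by
    have h1 : Tendsto (fun j : ℕ => 1 / ((j : ℝ) + 1)) atTop (𝓝 0) := tendsto_one_div_add_atTop_nhds_zero_nat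
    have h2 : Tendsto (fun j : ℕ => ν₀ * (1 / ((j : ℝ) + 1))) atTop (𝓝 (ν₀ * 0)) := h1.const_mul ν₀
    rw [mul_zero] at h2
    refine h2.congr fun j => ?_
    simp only [hνdef]
    ring
  refine ⟨f, hfs, hfdiv, hfmean, ν, 2 * E, ε₀, hνpos, hνlim, hε₀, fun j => ?_⟩
  obtain ⟨N₀, hN⟩ := h (ν j) (hνpos j) (hνle j)
  -- for all `N ≥ N₀`, hence frequently
  refine (eventually_atTop.2 ⟨N₀, fun N hN₀ => ?_⟩).frequently
  obtain ⟨U, hU, hmean, hsteady, hKE, hW⟩ := hN N hN₀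
  have hSS : SteadyState (ν j) N f U := steadyState_of_galerkinMode hU hmean hsteady
  refine ⟨U, hSS, ?_, ?_⟩
  · -- `∫‖U‖² = 2 · kineticEnergy U ≤ 2E`
    have h2 : ∫ x, ‖U x‖ ^ 2 = 2 * kineticEnergy U := by
      unfold kineticEnergy; ring
    rw [h2]
    linarith
  · -- loudness: `ε₀ ≤ (f,U) = ν_j ‖∇U‖²`
    rw [← work_eq_of_steady hfs.continuous hU hmean hsteady]
    exact hW

end Summit.AnomalousDissipation.AnomalousDissipation.Theorems.UniformGalerkinTrap

end
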